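import Literature.NumberTheory.Rogawski1990.TransferFactsCanonical
import Literature.NumberTheory.Automorphic.CompactCoreLevelPoint
import HarnessLib

/-!
# An `IsQuotientOf` orbital measure family READ AT A POINT: `m.atPoint γ = dν ∕ d(t transported to Z(γ))`
(Rogawski (1990), §1.7 p. 6, §4.3 (4.3.1) p. 43; Deitmar–Echterhoff (2014), Thm. 1.5.3)

Topic `NumberTheory/Automorphic`; namespaces `Literature.NumberTheory.Automorphic` (§1, generic locally compact second countable Hausdorff group
`G` with a two-sided Haar measure `ν`) and `….UnitaryGroup` (§2).  THEOREMS ONLY over accepted tree modules (no definition, no named fact, no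
instance, no notation, no `sorry`).

WHY.  The T1 engine line of the crux H413 pins the archimedean orbital measure family `m_∞` of the inner form in WEIL FORM: pin (xii)
`ArchCoherence` delivers torus measures `t' : ∀ γ', Measure Z(γ')` with ★ `OrbitalMeasureFamily.IsQuotientOf (IsRegularElt ·) ν_∞ t' m_∞` — the
quotient equation `m_∞ c = quotientMeasure Z(out c) (t' (out c)) ν_∞` at the CHOSEN REPRESENTATIVE of every regular CLASS `c` (★
`TransferFactsCanonical` §0).  The explicit geometric side (O10: ★ `UnitaryGroupAdelicOrbitalMeasureOfLocalQuotient`, the tower assembly and its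
reader) needs the equation at the POINT `γ_∞ = archPart (toAdelic γ_c)` of the class, i.e. for ★ `OrbitalMeasureFamily.atPoint` (the class measure
transported along the conjugator `conjOut γ`): `m_∞.atPoint γ_∞ = quotientMeasure Z(γ_∞) t_∞ ν_∞`.  The tree has this point reading for CANONICAL
families (★ `OrbitalMeasureFamily.IsCanonical.atPoint_eq_quotientMeasure`, absolute normalisation «mass one on the compact core»); this file is
the same transport for the RELATIVE (Weil) form, where the torus measure is a datum:

* `OrbitalMeasureFamily.IsQuotientOf.atPoint_eq_quotientMeasure_map` — for `m.IsQuotientOf P ν t` and `γ` with `P (out ⟦γ⟧)`: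
  `m.atPoint γ = quotientMeasure Z(γ) ((conj (conjOut γ))|_* (t (out ⟦γ⟧))) ν`, the torus measure transported along the conjugator
  (★ `map_cosetCongr_quotientMeasure` + ★ `map_mulAutConj_eq_self`: a two-sided Haar measure is conjugation invariant);
* `OrbitalMeasureFamily.IsQuotientOf.atPoint_eq_quotientMeasure` — the same with the transported torus measure ∃-packaged together with
  its two instance facts (Haar, inversion invariant) — the shape of the `(ti) [IsHaarMeasure ti] [ti.IsInvInvariant] (harch : m.atPoint γ =
  quotientMeasure Z(γ) ti _ ν)` binders of the tower assembly;
* `OrbitalMeasureFamily.IsQuotientOf.atPoint_eq_quotientMeasure_of_forall_map_conj_eq` — if the datum `t` is COHERENT UNDER CONJUGATION on the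
  `P`-points (`(conj q)|_* (t γ₁) = t γ₂` whenever `q γ₁ q⁻¹ = γ₂`) and `P` is conjugation-stable, then at every `P`-point `t γ` is Haar and
  inversion invariant and `m.atPoint γ = quotientMeasure Z(γ) (t γ) ν` — `ti := t γ` on the nose.

* §2 (`U(H)(L⁺ ⊗ ℝ) = UnitaryGroup.arch …`, every `N`, `det H ≠ 0`): for REGULAR `γ₁` the conjugation transport `Z(γ₁) ≃ Z(q γ₁ q⁻¹)` IS the
  stable-centraliser isomorphism ★ `UnitaryGroup.archStableCentralizerEquiv` (conjugation by ANY ambient conjugator, ★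
  `coe_archStableCentralizerEquiv_eq_of_conj_eq`), so pin (xii)'s STABLE coherence clause (C′) implies conjugation coherence:
  `UnitaryGroup.map_subgroupCongrHomeomorph_conj_eq_map_archStableCentralizerEquiv`, and the discharge
  **`UnitaryGroup.atPoint_eq_quotientMeasure_of_isQuotientOf_of_archCoherent`**: from (W′) + (C′) of the line's `ArchCoherence` (verbatim shapes, any
  proof of `det H ≠ 0`), at every regular `γ ∈ G_∞`, `t' γ` is Haar and inversion invariant and `m_∞.atPoint γ = quotientMeasure Z(γ) (t' γ) ν_∞`.

Deliberately NOT here: the finite places (there the families are CANONICAL and ★ `IsCanonical.atPoint_eq_quotientMeasure` applies), the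
endoscopic group `H_∞` (pair carrier) and the inner-twist clause (C′G).

## References
* J. D. Rogawski, *Automorphic Representations of Unitary Groups in Three Variables*, Ann. of Math. Stud. 123 (1990), §1.7 p. 6, §4.3 (4.3.1)
  p. 43 [Rogawski1990].
* A. Deitmar, S. Echterhoff, *Principles of Harmonic Analysis*, 2nd ed. (2014), Thm. 1.5.3 [DeitmarEchterhoff2014].
-/

set_option autoImplicit false

noncomputable section

open MeasureTheory Measure Set
open Literature.MeasureTheory.Group
open scoped ENNReal NNReal

namespace Literature.NumberTheory.Automorphic

section Conjugator

variable {G : Type*} [Group G]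

/-- The conjugator `conj (conjOut γ)` maps `Z(out ⟦γ⟧)` onto `Z(γ)` (membership form consumed by ★ `subgroupCongrHomeomorph` ∕ ★ `cosetCongr`).
[cite: DeitmarEchterhoff2014, Thm. 1.5.3] -/
theorem forall_mulAutConj_conjOut_mem_centralizer_iff (γ : G) :
    ∀ g, (MulAut.conj (conjOut γ) : G ≃* G) g ∈ Subgroup.centralizer ({γ} : Set G) ↔
      g ∈ Subgroup.centralizer ({(Quotient.out (ConjClasses.mk γ) : G)} : Set G) :=
  forall_apply_mem_centralizer_singleton_iff_of_eq (MulAut.conj (conjOut γ)) (conj_conjOut_out γ)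

/-- The chosen representative of `⟦γ⟧` is the conjugate `(conjOut γ)⁻¹ γ (conjOut γ)` of `γ`. [cite: DeitmarEchterhoff2014, Thm. 1.5.3] -/
theorem out_conjClassesMk_eq_conj (γ : G) :
    (Quotient.out (ConjClasses.mk γ) : G) = (conjOut γ)⁻¹ * γ * (conjOut γ)⁻¹⁻¹ := by
  have h0 : conjOut γ * Quotient.out (ConjClasses.mk γ) * (conjOut γ)⁻¹ = γ := conj_conjOut_out γ
  calc (Quotient.out (ConjClasses.mk γ) : G)
      = (conjOut γ)⁻¹ * (conjOut γ * Quotient.out (ConjClasses.mk γ) * (conjOut γ)⁻¹) * (conjOut γ)⁻¹⁻¹ := by group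
    _ = (conjOut γ)⁻¹ * γ * (conjOut γ)⁻¹⁻¹ := by rw [h0]

end Conjugator

section AtPoint

variable {G : Type*} [Group G] [TopologicalSpace G] [IsTopologicalGroup G] [LocallyCompactSpace G]
  [SecondCountableTopology G] [T2Space G] [MeasurableSpace G] [BorelSpace G]
  [∀ γ : G, MeasurableSpace (G ⧸ Subgroup.centralizer ({γ} : Set G))]
  [∀ γ : G, BorelSpace (G ⧸ Subgroup.centralizer ({γ} : Set G))]

omit [∀ γ : G, MeasurableSpace (G ⧸ Subgroup.centralizer ({γ} : Set G))]
  [∀ γ : G, BorelSpace (G ⧸ Subgroup.centralizer ({γ} : Set G))] in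
/-- The invariant quotient measure `dν ∕ dρ` depends on the torus measure `ρ` only (not on the instance witnesses): equal measures give
equal quotients. [cite: DeitmarEchterhoff2014, Thm. 1.5.3] -/
private theorem quotientMeasure_congr_of_eq {Z : Subgroup G} (hZ : IsClosed (Z : Set G)) [LocallyCompactSpace Z]
    [SecondCountableTopology Z] [MeasurableSpace (G ⧸ Z)] [BorelSpace (G ⧸ Z)] (ν : Measure G) [ν.IsHaarMeasure]
    [ν.IsMulRightInvariant] (ρ₁ ρ₂ : Measure Z) [ρ₁.IsHaarMeasure] [ρ₁.IsInvInvariant] [ρ₂.IsHaarMeasure] [ρ₂.IsInvInvariant]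
    (h : ρ₁ = ρ₂) : quotientMeasure Z ρ₁ hZ ν = quotientMeasure Z ρ₂ hZ ν := by
  subst h
  rfl

/-- **An `IsQuotientOf` family read at a point — explicit transport.**  If `m` is the quotient family of `ν` by the given centraliser measures
`t` on the `P`-classes (★ `OrbitalMeasureFamily.IsQuotientOf`) and `P (out ⟦γ⟧)`, then
`m.atPoint γ = quotientMeasure Z(γ) ((conj (conjOut γ))|_* (t (out ⟦γ⟧))) ν`: the class measure `m ⟦γ⟧ = dν ∕ dt_{out ⟦γ⟧}` transported along the
conjugator taking `out ⟦γ⟧` to `γ` is the quotient of (the conjugation-invariant) `ν` by the transported torus measure (★ `map_cosetCongr_quotientMeasure`,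
★ `map_mulAutConj_eq_self`).  «Measures `dg` and `dg′` … are said to be compatible if `dg = c|Ω|` and `dg′ = c|Ω′|` … the orbital integrals are defined
using compatible measures on `H_{γ′}` and `G_γ`» — compatibility is transport, and this is its bookkeeping inside one class.
[cite: Rogawski1990, §1.7 p. 6; §4.3 (4.3.1) p. 43] [cite: DeitmarEchterhoff2014, Thm. 1.5.3] -/
theorem OrbitalMeasureFamily.IsQuotientOf.atPoint_eq_quotientMeasure_map {P : G → Prop} {ν : Measure G} [ν.IsHaarMeasure]
    [ν.IsMulRightInvariant] {t : ∀ γ : G, Measure (Subgroup.centralizer ({γ} : Set G))} {m : OrbitalMeasureFamily G}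
    (h : m.IsQuotientOf P ν t) (γ : G) (hc : P (Quotient.out (ConjClasses.mk γ))) :
    ∃ (_ : (Measure.map (subgroupCongrHomeomorph (MulAut.conj (conjOut γ) : G ≃* G)
          (Subgroup.centralizer ({(Quotient.out (ConjClasses.mk γ) : G)} : Set G)) (Subgroup.centralizer ({γ} : Set G))
          (forall_mulAutConj_conjOut_mem_centralizer_iff γ) (continuous_mulAutConj (conjOut γ)) (continuous_mulAutConj_symm (conjOut γ)))
        (t (Quotient.out (ConjClasses.mk γ)))).IsHaarMeasure)
      (_ : (Measure.map (subgroupCongrHomeomorph (MulAut.conj (conjOut γ) : G ≃* G)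
          (Subgroup.centralizer ({(Quotient.out (ConjClasses.mk γ) : G)} : Set G)) (Subgroup.centralizer ({γ} : Set G))
          (forall_mulAutConj_conjOut_mem_centralizer_iff γ) (continuous_mulAutConj (conjOut γ)) (continuous_mulAutConj_symm (conjOut γ)))
        (t (Quotient.out (ConjClasses.mk γ)))).IsInvInvariant),
      m.atPoint γ = quotientMeasure (Subgroup.centralizer ({γ} : Set G))
        (Measure.map (subgroupCongrHomeomorph (MulAut.conj (conjOut γ) : G ≃* G)
          (Subgroup.centralizer ({(Quotient.out (ConjClasses.mk γ) : G)} : Set G)) (Subgroup.centralizer ({γ} : Set G))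
          (forall_mulAutConj_conjOut_mem_centralizer_iff γ) (continuous_mulAutConj (conjOut γ)) (continuous_mulAutConj_symm (conjOut γ)))
          (t (Quotient.out (ConjClasses.mk γ))))
        (isClosed_coe_centralizer_singleton γ) ν := by
  obtain ⟨ht, hti, hmc⟩ := h _ hc
  have he : Continuous (MulAut.conj (conjOut γ) : G ≃* G) := continuous_mulAutConj (conjOut γ)
  have hes : Continuous (MulAut.conj (conjOut γ) : G ≃* G).symm := continuous_mulAutConj_symm (conjOut γ)
  haveI hZc : IsClosed ((Subgroup.centralizer ({(Quotient.out (ConjClasses.mk γ) : G)} : Set G) : Subgroup G) : Set G) :=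
    isClosed_coe_centralizer_singleton _
  haveI hZ'c : IsClosed ((Subgroup.centralizer ({γ} : Set G) : Subgroup G) : Set G) :=
    isClosed_coe_centralizer_singleton γ
  haveI : LocallyCompactSpace (Subgroup.centralizer ({(Quotient.out (ConjClasses.mk γ) : G)} : Set G)) :=
    hZc.isClosedEmbedding_subtypeVal.locallyCompactSpace
  haveI : SecondCountableTopology (Subgroup.centralizer ({(Quotient.out (ConjClasses.mk γ) : G)} : Set G)) :=
    TopologicalSpace.Subtype.secondCountableTopology _
  haveI : LocallyCompactSpace (Subgroup.centralizer ({γ} : Set G)) :=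
    hZ'c.isClosedEmbedding_subtypeVal.locallyCompactSpace
  haveI : SecondCountableTopology (Subgroup.centralizer ({γ} : Set G)) :=
    TopologicalSpace.Subtype.secondCountableTopology _
  -- the restriction `Z(out ⟦γ⟧) ≃ Z(γ)`, as a homeomorphism and as a continuous multiplicative equivalence
  let eH : Subgroup.centralizer ({(Quotient.out (ConjClasses.mk γ) : G)} : Set G) ≃ₜ
      Subgroup.centralizer ({γ} : Set G) :=
    subgroupCongrHomeomorph (MulAut.conj (conjOut γ) : G ≃* G) _ _ (forall_mulAutConj_conjOut_mem_centralizer_iff γ) he hes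
  let eZ : Subgroup.centralizer ({(Quotient.out (ConjClasses.mk γ) : G)} : Set G) ≃ₜ*
      Subgroup.centralizer ({γ} : Set G) :=
    { toMulEquiv :=
        { toEquiv := eH.toEquiv
          map_mul' := fun a b => Subtype.ext
            (map_mul (MulAut.conj (conjOut γ) : G ≃* G) (a : G) (b : G)) }
      continuous_toFun := eH.continuous
      continuous_invFun := eH.symm.continuous }
  -- the transported torus measure `(eH)_* t` is Haar and inversion invariant
  haveI ht'1 : (Measure.map eH (t (Quotient.out (ConjClasses.mk γ)))).IsHaarMeasure :=
    MulEquiv.isHaarMeasure_map (t (Quotient.out (ConjClasses.mk γ))) eZ.toMulEquiv eZ.continuous eZ.symm.continuous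
  haveI ht'2 : (Measure.map eH (t (Quotient.out (ConjClasses.mk γ)))).IsInvInvariant :=
    isInvInvariant_map_mulEquiv eZ.toMulEquiv eZ.continuous.measurable (t (Quotient.out (ConjClasses.mk γ)))
  refine ⟨ht'1, ht'2, ?_⟩
  have hmap := map_cosetCongr_quotientMeasure (MulAut.conj (conjOut γ) : G ≃* G) he hes _ _
    (forall_mulAutConj_conjOut_mem_centralizer_iff γ) (t (Quotient.out (ConjClasses.mk γ)))
    (Measure.map eH (t (Quotient.out (ConjClasses.mk γ)))) ν ν rfl (map_mulAutConj_eq_self ν (conjOut γ)).symm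
  unfold OrbitalMeasureFamily.atPoint
  rw [hmc]
  exact hmap

/-- **An `IsQuotientOf` family read at a point — ∃-packaged.**  For `m.IsQuotientOf P ν t` and `P (out ⟦γ⟧)` there is a Haar, inversion-invariant
measure `ti` on `Z(γ)` with `m.atPoint γ = quotientMeasure Z(γ) ti ν`, namely the transport of `t (out ⟦γ⟧)` along the conjugator — exactly the
binders `(ti) [IsHaarMeasure ti] [ti.IsInvInvariant] (harch : m.atPoint γ = quotientMeasure Z(γ) ti _ ν)` of the explicit geometric side.
[cite: Rogawski1990, §4.3 (4.3.1) p. 43] [cite: DeitmarEchterhoff2014, Thm. 1.5.3] -/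
theorem OrbitalMeasureFamily.IsQuotientOf.atPoint_eq_quotientMeasure {P : G → Prop} {ν : Measure G} [ν.IsHaarMeasure]
    [ν.IsMulRightInvariant] {t : ∀ γ : G, Measure (Subgroup.centralizer ({γ} : Set G))} {m : OrbitalMeasureFamily G}
    (h : m.IsQuotientOf P ν t) (γ : G) (hc : P (Quotient.out (ConjClasses.mk γ))) :
    ∃ ti : Measure (Subgroup.centralizer ({γ} : Set G)), ∃ (_ : ti.IsHaarMeasure) (_ : ti.IsInvInvariant),
      m.atPoint γ = quotientMeasure (Subgroup.centralizer ({γ} : Set G)) ti (isClosed_coe_centralizer_singleton γ) ν ∧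
        ti = Measure.map (subgroupCongrHomeomorph (MulAut.conj (conjOut γ) : G ≃* G)
          (Subgroup.centralizer ({(Quotient.out (ConjClasses.mk γ) : G)} : Set G)) (Subgroup.centralizer ({γ} : Set G))
          (forall_mulAutConj_conjOut_mem_centralizer_iff γ) (continuous_mulAutConj (conjOut γ)) (continuous_mulAutConj_symm (conjOut γ)))
          (t (Quotient.out (ConjClasses.mk γ))) := by
  obtain ⟨h1, h2, h3⟩ := h.atPoint_eq_quotientMeasure_map γ hc
  exact ⟨_, h1, h2, h3, rfl⟩

/-- **Coherent data: `ti := t γ` on the nose.**  If the centraliser measures `t` are COHERENT UNDER CONJUGATION on the `P`-points — transporting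
`t γ₁` along `conj q : Z(γ₁) ≃ Z(q γ₁ q⁻¹)` gives `t (q γ₁ q⁻¹)` — and `P` is conjugation-stable, then at every `γ` with `P γ`:
`m.atPoint γ = quotientMeasure Z(γ) (t γ) ν`.  (For the T1 line: the kit's archimedean torus measures `t'` of pin (xii), read at `γ_∞` itself.)
[cite: Rogawski1990, §1.7 p. 6; §4.3 (4.3.1) p. 43] [cite: DeitmarEchterhoff2014, Thm. 1.5.3] -/
theorem OrbitalMeasureFamily.IsQuotientOf.atPoint_eq_quotientMeasure_of_forall_map_conj_eq {P : G → Prop} {ν : Measure G} [ν.IsHaarMeasure]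
    [ν.IsMulRightInvariant] {t : ∀ γ : G, Measure (Subgroup.centralizer ({γ} : Set G))} {m : OrbitalMeasureFamily G}
    (h : m.IsQuotientOf P ν t) (hP : ∀ (γ₁ q : G), P γ₁ → P (q * γ₁ * q⁻¹))
    (hcoh : ∀ (γ₁ γ₂ q : G) (hq : (MulAut.conj q : G ≃* G) γ₁ = γ₂), P γ₁ →
      Measure.map (subgroupCongrHomeomorph (MulAut.conj q : G ≃* G) (Subgroup.centralizer ({γ₁} : Set G))
        (Subgroup.centralizer ({γ₂} : Set G)) (forall_apply_mem_centralizer_singleton_iff_of_eq (MulAut.conj q : G ≃* G) hq)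
        (continuous_mulAutConj q) (continuous_mulAutConj_symm q)) (t γ₁) = t γ₂)
    (γ : G) (hγ : P γ) :
    ∃ (_ : (t γ).IsHaarMeasure) (_ : (t γ).IsInvInvariant),
      m.atPoint γ = quotientMeasure (Subgroup.centralizer ({γ} : Set G)) (t γ) (isClosed_coe_centralizer_singleton γ) ν := by
  -- `P` at the representative `out ⟦γ⟧ = q γ q⁻¹`, `q = (conjOut γ)⁻¹`
  have hc : P (Quotient.out (ConjClasses.mk γ)) := by
    rw [out_conjClassesMk_eq_conj γ]
    exact hP γ _ hγ
  obtain ⟨h1, h2, h3⟩ := h.atPoint_eq_quotientMeasure_map γ hc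
  -- coherence at `γ₁ := out ⟦γ⟧`, `q := conjOut γ`: the transported torus measure IS `t γ`
  have key := hcoh (Quotient.out (ConjClasses.mk γ)) γ (conjOut γ) (conj_conjOut_out γ) hc
  haveI hZ'c : IsClosed ((Subgroup.centralizer ({γ} : Set G) : Subgroup G) : Set G) := isClosed_coe_centralizer_singleton γ
  haveI : LocallyCompactSpace (Subgroup.centralizer ({γ} : Set G)) := hZ'c.isClosedEmbedding_subtypeVal.locallyCompactSpace
  haveI : SecondCountableTopology (Subgroup.centralizer ({γ} : Set G)) := TopologicalSpace.Subtype.secondCountableTopology _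
  haveI ht1 : (t γ).IsHaarMeasure := key ▸ h1
  haveI ht2 : (t γ).IsInvInvariant := key ▸ h2
  refine ⟨ht1, ht2, ?_⟩
  rw [h3]
  exact quotientMeasure_congr_of_eq _ ν _ _ key

end AtPoint

/-! ## §2 The archimedean unitary group: conjugation-coherence from pin (xii)'s STABLE coherence -/

namespace UnitaryGroup

open Literature.NumberTheory.Rogawski1990 _root_.NumberField

variable (L : Type) [Field L] [NumberField L] [IsCMField L] {N : ℕ} {H : Matrix (Fin N) (Fin N) L}

/-- Conjugate elements of `G_∞ = U(H)(L⁺ ⊗ ℝ)` correspond (are stably conjugate: conjugate in the ambient `GL_N(L ⊗ ℝ)`).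
[cite: Rogawski1990, §3.1 p. 19; §14.1 p. 232] -/
theorem corresponds_arch_of_mulAutConj_eq {γ₁ γ₂ : arch (↥(maximalRealSubfield L)) L (IsCMField.complexConj L) N H}
    (q : arch (↥(maximalRealSubfield L)) L (IsCMField.complexConj L) N H)
    (hq : (MulAut.conj q : _ ≃* arch (↥(maximalRealSubfield L)) L (IsCMField.complexConj L) N H) γ₁ = γ₂) :
    Corresponds (conjMixed (↥(maximalRealSubfield L)) L (IsCMField.complexConj L)) (archFormOf L N H) (archFormOf L N H) γ₁ γ₂ :=
  isConj_iff.mpr ⟨(q : GL (Fin N) (mixedEmbedding.mixedSpace L)), congrArg Subtype.val hq⟩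

/-- Regularity is stable under conjugation in `G_∞`. [cite: Rogawski1990, §3.1 p. 19] -/
theorem isRegularElt_mulAutConj_arch {γ₁ : arch (↥(maximalRealSubfield L)) L (IsCMField.complexConj L) N H}
    (q : arch (↥(maximalRealSubfield L)) L (IsCMField.complexConj L) N H)
    (h₁ : IsRegularElt (γ₁.val : GL (Fin N) (mixedEmbedding.mixedSpace L))) :
    IsRegularElt ((q * γ₁ * q⁻¹).val : GL (Fin N) (mixedEmbedding.mixedSpace L)) :=
  isRegularElt_of_isConj (corresponds_arch_of_mulAutConj_eq L q rfl) h₁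

variable [MeasurableSpace (arch (↥(maximalRealSubfield L)) L (IsCMField.complexConj L) N H)]

/-- **For REGULAR `γ₁`, transport along the conjugator IS transport along the stable-centraliser isomorphism**: the conjugation homeomorphism
`Z(γ₁) ≃ₜ Z(q γ₁ q⁻¹)` and ★ `archStableCentralizerEquiv` (conjugation by ANY ambient conjugator, ★ `coe_archStableCentralizerEquiv_eq_of_conj_eq`)
agree, so they push every torus measure forward to the same measure.  (The centraliser of a regular element has commutative ambient commutant, so the
induced map on the torus does not depend on the conjugator.) [cite: Rogawski1990, §3.1 p. 19; §4.3 pp. 43–44] -/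
theorem map_subgroupCongrHomeomorph_conj_eq_map_archStableCentralizerEquiv (hH : H.det ≠ 0)
    {γ₁ γ₂ : arch (↥(maximalRealSubfield L)) L (IsCMField.complexConj L) N H} (q : arch (↥(maximalRealSubfield L)) L (IsCMField.complexConj L) N H)
    (hq : (MulAut.conj q : _ ≃* arch (↥(maximalRealSubfield L)) L (IsCMField.complexConj L) N H) γ₁ = γ₂)
    (h₁ : IsRegularElt (γ₁.val : GL (Fin N) (mixedEmbedding.mixedSpace L)))
    (hc : Corresponds (conjMixed (↥(maximalRealSubfield L)) L (IsCMField.complexConj L)) (archFormOf L N H) (archFormOf L N H) γ₁ γ₂)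
    (μ : Measure (Subgroup.centralizer ({γ₁} : Set (arch (↥(maximalRealSubfield L)) L (IsCMField.complexConj L) N H)))) :
    Measure.map (subgroupCongrHomeomorph (MulAut.conj q : _ ≃* arch (↥(maximalRealSubfield L)) L (IsCMField.complexConj L) N H)
        (Subgroup.centralizer ({γ₁} : Set _)) (Subgroup.centralizer ({γ₂} : Set _))
        (forall_apply_mem_centralizer_singleton_iff_of_eq (MulAut.conj q : _ ≃* _) hq)
        (continuous_mulAutConj q) (continuous_mulAutConj_symm q)) μ =
      Measure.map (archStableCentralizerEquiv L hH hH hc h₁) μ := by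
  have hy : (q : GL (Fin N) (mixedEmbedding.mixedSpace L)) * (γ₁.val : GL (Fin N) (mixedEmbedding.mixedSpace L)) *
      (q : GL (Fin N) (mixedEmbedding.mixedSpace L))⁻¹ = γ₂.val := congrArg Subtype.val hq
  have hfun : (subgroupCongrHomeomorph (MulAut.conj q : _ ≃* arch (↥(maximalRealSubfield L)) L (IsCMField.complexConj L) N H)
        (Subgroup.centralizer ({γ₁} : Set _)) (Subgroup.centralizer ({γ₂} : Set _))
        (forall_apply_mem_centralizer_singleton_iff_of_eq (MulAut.conj q : _ ≃* _) hq)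
        (continuous_mulAutConj q) (continuous_mulAutConj_symm q) : _ → Subgroup.centralizer ({γ₂} : Set _)) =
      (archStableCentralizerEquiv L hH hH hc h₁ : _ → Subgroup.centralizer ({γ₂} : Set _)) := by
    funext z
    apply Subtype.ext
    apply Subtype.ext
    rw [coe_subgroupCongrHomeomorph_apply]
    change ((q * (z : arch (↥(maximalRealSubfield L)) L (IsCMField.complexConj L) N H) * q⁻¹ :
        arch (↥(maximalRealSubfield L)) L (IsCMField.complexConj L) N H).val : GL (Fin N) (mixedEmbedding.mixedSpace L)) = _
    rw [coe_archStableCentralizerEquiv_eq_of_conj_eq L hH hH hc h₁ (q : GL (Fin N) (mixedEmbedding.mixedSpace L)) hy z]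
    rfl
  rw [hfun]

variable [BorelSpace (arch (↥(maximalRealSubfield L)) L (IsCMField.complexConj L) N H)]
  [∀ γ : arch (↥(maximalRealSubfield L)) L (IsCMField.complexConj L) N H,
    MeasurableSpace (arch (↥(maximalRealSubfield L)) L (IsCMField.complexConj L) N H ⧸
      Subgroup.centralizer ({γ} : Set (arch (↥(maximalRealSubfield L)) L (IsCMField.complexConj L) N H)))]
  [∀ γ : arch (↥(maximalRealSubfield L)) L (IsCMField.complexConj L) N H,
    BorelSpace (arch (↥(maximalRealSubfield L)) L (IsCMField.complexConj L) N H ⧸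
      Subgroup.centralizer ({γ} : Set (arch (↥(maximalRealSubfield L)) L (IsCMField.complexConj L) N H)))]

/-- **PIN (xii) READ AT A REGULAR POINT.**  If the archimedean family `m_∞` is the Weil quotient of `ν_∞` by torus measures `t'` on the regular
classes — (W′) `m_∞.IsQuotientOf (IsRegularElt ·) ν_∞ t'` — and `t'` is coherent under STABLE conjugacy inside `G_∞` — (C′)
`(archStableCentralizerEquiv … hc h₁)_* (t' γ₁) = t' γ₂`, the two clauses of the T1 line's `ArchCoherence` VERBATIM (any proof of `det H ≠ 0`) —
then at every REGULAR `γ ∈ G_∞` the torus measure `t' γ` is Haar and inversion invariant and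
`m_∞.atPoint γ = quotientMeasure Z(γ) (t' γ) ν_∞`: the `(ti := t' γ_∞) (harch)` binders of the explicit geometric side (O10 tower assembly ∕ reader),
discharged from the pin. [cite: Rogawski1990, §4.3 (4.3.1) p. 43; §1.7 p. 6] [cite: DeitmarEchterhoff2014, Thm. 1.5.3] -/
theorem atPoint_eq_quotientMeasure_of_isQuotientOf_of_archCoherent (hH : H.det ≠ 0)
    {ν : Measure (arch (↥(maximalRealSubfield L)) L (IsCMField.complexConj L) N H)} [ν.IsHaarMeasure] [ν.IsMulRightInvariant]
    {t' : ∀ γ' : arch (↥(maximalRealSubfield L)) L (IsCMField.complexConj L) N H, Measure (Subgroup.centralizer ({γ'} : Set _))}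
    {m : OrbitalMeasureFamily (arch (↥(maximalRealSubfield L)) L (IsCMField.complexConj L) N H)}
    (hW : m.IsQuotientOf (fun γ => IsRegularElt (γ.val : GL (Fin N) (mixedEmbedding.mixedSpace L))) ν t')
    (hC : ∀ (γ₁ γ₂ : arch (↥(maximalRealSubfield L)) L (IsCMField.complexConj L) N H)
        (h₁ : IsRegularElt (γ₁.val : GL (Fin N) (mixedEmbedding.mixedSpace L)))
        (hc : Corresponds (conjMixed (↥(maximalRealSubfield L)) L (IsCMField.complexConj L)) (archFormOf L N H) (archFormOf L N H) γ₁ γ₂),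
        Measure.map (archStableCentralizerEquiv L hH hH hc h₁) (t' γ₁) = t' γ₂)
    (γ : arch (↥(maximalRealSubfield L)) L (IsCMField.complexConj L) N H)
    (hγ : IsRegularElt (γ.val : GL (Fin N) (mixedEmbedding.mixedSpace L))) :
    ∃ (_ : (t' γ).IsHaarMeasure) (_ : (t' γ).IsInvInvariant),
      m.atPoint γ = quotientMeasure (Subgroup.centralizer ({γ} : Set _)) (t' γ) (isClosed_coe_centralizer_singleton γ) ν :=
  hW.atPoint_eq_quotientMeasure_of_forall_map_conj_eq (fun _ q h => isRegularElt_mulAutConj_arch L q h)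
    (fun γ₁ γ₂ q hq h₁ => (map_subgroupCongrHomeomorph_conj_eq_map_archStableCentralizerEquiv L hH q hq h₁
      (corresponds_arch_of_mulAutConj_eq L q hq) (t' γ₁)).trans (hC γ₁ γ₂ h₁ (corresponds_arch_of_mulAutConj_eq L q hq))) γ hγ

end UnitaryGroup

end Literature.NumberTheory.Automorphic
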